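import Mathlib
import HarnessLib
import Summits.Schanuel.Schanuel.Theses.BakerOverExpField

/-!
# Birth skeleton — crux `AffineToAlgebraic` (route `BakerOverExpField`, item `stmt-Schanuel-19262`)

Published as `Summits/Schanuel/Schanuel/Cruxes/AffineToAlgebraic/Lines/birth.lean` (BC3 skeleton of
the route's RESIDUAL conjunct X2).

Notation (informal): for `ℚ`-linearly independent `z : Fin n → ℂ` put `K = ℚ(e^{z₁},…,e^{zₙ})`,
`b = trdeg_ℚ K`, `L = algebraicClosure K ℂ` (the algebraic closure of `K` inside `ℂ`),
`d = dim_L span_L {1, z₁, …, zₙ}`, `F = ℚ(z, e^z)`, `T = trdeg_ℚ F`.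
The crux `AffineToAlgebraic` reads `∀ z lin. indep., (n ≤ T) ∨ (d + b ≤ T + 1)`.

## The line (regime decomposition by the position of `z` relative to `L`)

* `stub_logSector` — the `b = 0` layer: `ℚ`-linearly independent logarithms of algebraic numbers
  are algebraically independent (the conjecture of algebraic independence of logarithms, verbatim
  the shared item `LogPatterns.LogSector` = `Literature.Barriers.Schanuel.AlgIndepLogarithms`).
  In the glue it yields the FIRST disjunct `n ≤ T` (an algebraically independent `n`-family inside
  `F` forces `trdeg_ℚ F ≥ n`).
* `stub_closureLayer` — the layer `z ⊂ L` (every `zᵢ` algebraic over `K`): then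
  `span_L {1, z} = L · 1`, so `d = 1`, and `b = trdeg_ℚ K ≤ trdeg_ℚ F = T` by monotonicity, whence
  `d + b ≤ T + 1` (SECOND disjunct). Provable now (finrank of the span of scalars + `trdeg_mono`);
  it is the rung of X2 that holds at e.g. `z = (1, e, e²)` where Schanuel itself is open.
* `stub_transcendentalLayer` — the genuinely open remainder: some `e^{zᵢ}` transcendental
  (`b ≥ 1`) AND some `zⱼ ∉ L` (transcendental over `K`). Content: the `zⱼ` outside `L` that are
  `L`-linearly independent modulo `L` must be algebraically independent over `L` ("L-affine
  independence upgrades to algebraic independence"), unless Schanuel's inequality already holds at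
  `z`; first open instance `n = 3`, `b = 1` (e.g. `z = (1, iπ, log 2)`, `L = ℚ(e)^alg`).
* `affineToAlgebraic_of_layers` (glue, sorry-free; conclusion = the crux body verbatim) and
  `AffineToAlgebraic_of : AffineToAlgebraic` (the crux BY NAME from the three stubs): case split on
  `∀ i, zᵢ ∈ L` and on `∀ i, e^{zᵢ} ∈ ℚ̄`; in the log sector the algebraic independence given by
  `stub_logSector` is pushed into `F` (`AlgebraicIndependent.of_comp F.val`,
  `AlgebraicIndependent.cardinalMk_le_trdeg`).

Sorries: exactly three, one inside each `stub_*`; none elsewhere (`affineToAlgebraic_of_layers`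
depends only on propext / Classical.choice / Quot.sound; `AffineToAlgebraic_of` reaches `sorryAx`
only through the three stubs).
-/

namespace Summit.Schanuel.Schanuel.Cruxes.AffineToAlgebraic.Birth

open Summit.Schanuel.Schanuel.Theses.BakerOverExpField (AffineToAlgebraic)

/-- STUB (log sector, `b = 0` layer): `ℚ`-linearly independent logarithms of algebraic numbers are
algebraically independent over `ℚ` — the conjecture of algebraic independence of logarithms
(Waldschmidt2005 Conj. 1.1; Roy1995 Introduction), verbatim the shared item
`Summit.Schanuel.Schanuel.Theses.LogPatterns.LogSector` and the registered open statement
`Literature.Barriers.Schanuel.AlgIndepLogarithms`. Open (two algebraically independent logarithms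
are not known). -/
theorem stub_logSector :
    ∀ (n : ℕ) (l : Fin n → ℂ), (∀ i, IsAlgebraic ℚ (Complex.exp (l i))) → LinearIndependent ℚ l →
      AlgebraicIndependent ℚ l := by
  sorry

/-- STUB (closure layer, `z ⊂ L`): if every `zᵢ` lies in `L = algebraicClosure ℚ(e^z) ℂ`, then
`dim_L span_L {1, z} + trdeg_ℚ ℚ(e^z) ≤ trdeg_ℚ ℚ(z, e^z) + 1` — indeed the span is `L · 1`
(`d = 1`) and `trdeg` is monotone along `ℚ(e^z) ≤ ℚ(z, e^z)`. Provable now; the first rung of X2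
outside Schanuel's known regime (e.g. `z = (1, e, e²)`). -/
theorem stub_closureLayer :
    ∀ (n : ℕ) (z : Fin n → ℂ), LinearIndependent ℚ z →
      (∀ i, z i ∈ algebraicClosure (IntermediateField.adjoin ℚ (Set.range (Complex.exp ∘ z))) ℂ) →
      (Module.finrank (algebraicClosure (IntermediateField.adjoin ℚ (Set.range (Complex.exp ∘ z))) ℂ)
          (Submodule.span (algebraicClosure (IntermediateField.adjoin ℚ (Set.range (Complex.exp ∘ z))) ℂ)
            (insert (1 : ℂ) (Set.range z))) : Cardinal) +
        Algebra.trdeg ℚ (IntermediateField.adjoin ℚ (Set.range (Complex.exp ∘ z))) ≤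
      Algebra.trdeg ℚ (IntermediateField.adjoin ℚ (Set.range z ∪ Set.range (Complex.exp ∘ z))) + 1 := by
  sorry

/-- STUB (transcendental affine layer, the open remainder of X2): for `ℚ`-linearly independent `z`
with some `e^{zᵢ}` transcendental (`b ≥ 1`) and some `zⱼ ∉ L` (transcendental over `ℚ(e^z)`),
either Schanuel's inequality holds at `z` or `d + b ≤ trdeg_ℚ ℚ(z, e^z) + 1`, i.e. the `zⱼ`
outside `L` that are `L`-linearly independent modulo `L` are algebraically independent over `L`.
First open instance `n = 3`, `b = 1` (`z = (1, iπ, log 2)`, four exponentials flavour); no known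
method outputs non-linear independence over a transcendental coefficient field (Chudnovsky1984
ch. 2 is conditional on a transcendence type). -/
theorem stub_transcendentalLayer :
    ∀ (n : ℕ) (z : Fin n → ℂ), LinearIndependent ℚ z →
      (∃ i, Transcendental ℚ (Complex.exp (z i))) →
      (∃ j, z j ∉ algebraicClosure (IntermediateField.adjoin ℚ (Set.range (Complex.exp ∘ z))) ℂ) →
      (n : Cardinal) ≤
          Algebra.trdeg ℚ (IntermediateField.adjoin ℚ (Set.range z ∪ Set.range (Complex.exp ∘ z))) ∨
        (Module.finrank (algebraicClosure (IntermediateField.adjoin ℚ (Set.range (Complex.exp ∘ z))) ℂ)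
            (Submodule.span (algebraicClosure (IntermediateField.adjoin ℚ (Set.range (Complex.exp ∘ z))) ℂ)
              (insert (1 : ℂ) (Set.range z))) : Cardinal) +
          Algebra.trdeg ℚ (IntermediateField.adjoin ℚ (Set.range (Complex.exp ∘ z))) ≤
        Algebra.trdeg ℚ (IntermediateField.adjoin ℚ (Set.range z ∪ Set.range (Complex.exp ∘ z))) + 1 := by
  sorry

/-- GLUE (proved, sorry-free): the three layers imply the crux. The conclusion is the body of
`Summit.Schanuel.Schanuel.Theses.BakerOverExpField.AffineToAlgebraic` VERBATIM (definitionally the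
crux; stated unfolded so that `AffineToAlgebraic_of` below is the file's only theorem whose type is
the crux constant). Case `z ⊂ L`: layer 2 gives the second disjunct. Otherwise, if every `e^{zᵢ}` is
algebraic, layer 1 (AIL) makes `z` algebraically independent over `ℚ`; pushed into `F = ℚ(z, e^z)`
(`AlgebraicIndependent.of_comp F.val`, `AlgebraicIndependent.cardinalMk_le_trdeg`) this is
`n ≤ trdeg_ℚ F`, the first disjunct. Otherwise layer 3 applies verbatim. -/
theorem affineToAlgebraic_of_layers
    (h₁ : ∀ (n : ℕ) (l : Fin n → ℂ), (∀ i, IsAlgebraic ℚ (Complex.exp (l i))) →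
      LinearIndependent ℚ l → AlgebraicIndependent ℚ l)
    (h₂ : ∀ (n : ℕ) (z : Fin n → ℂ), LinearIndependent ℚ z →
      (∀ i, z i ∈ algebraicClosure (IntermediateField.adjoin ℚ (Set.range (Complex.exp ∘ z))) ℂ) →
      (Module.finrank (algebraicClosure (IntermediateField.adjoin ℚ (Set.range (Complex.exp ∘ z))) ℂ)
          (Submodule.span (algebraicClosure (IntermediateField.adjoin ℚ (Set.range (Complex.exp ∘ z))) ℂ)
            (insert (1 : ℂ) (Set.range z))) : Cardinal) +
        Algebra.trdeg ℚ (IntermediateField.adjoin ℚ (Set.range (Complex.exp ∘ z))) ≤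
      Algebra.trdeg ℚ (IntermediateField.adjoin ℚ (Set.range z ∪ Set.range (Complex.exp ∘ z))) + 1)
    (h₃ : ∀ (n : ℕ) (z : Fin n → ℂ), LinearIndependent ℚ z →
      (∃ i, Transcendental ℚ (Complex.exp (z i))) →
      (∃ j, z j ∉ algebraicClosure (IntermediateField.adjoin ℚ (Set.range (Complex.exp ∘ z))) ℂ) →
      (n : Cardinal) ≤
          Algebra.trdeg ℚ (IntermediateField.adjoin ℚ (Set.range z ∪ Set.range (Complex.exp ∘ z))) ∨
        (Module.finrank (algebraicClosure (IntermediateField.adjoin ℚ (Set.range (Complex.exp ∘ z))) ℂ)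
            (Submodule.span (algebraicClosure (IntermediateField.adjoin ℚ (Set.range (Complex.exp ∘ z))) ℂ)
              (insert (1 : ℂ) (Set.range z))) : Cardinal) +
          Algebra.trdeg ℚ (IntermediateField.adjoin ℚ (Set.range (Complex.exp ∘ z))) ≤
        Algebra.trdeg ℚ (IntermediateField.adjoin ℚ (Set.range z ∪ Set.range (Complex.exp ∘ z))) + 1) :
    ∀ (n : ℕ) (z : Fin n → ℂ), LinearIndependent ℚ z →
      (n : Cardinal) ≤
          Algebra.trdeg ℚ (IntermediateField.adjoin ℚ (Set.range z ∪ Set.range (Complex.exp ∘ z))) ∨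
        (Module.finrank (algebraicClosure (IntermediateField.adjoin ℚ (Set.range (Complex.exp ∘ z))) ℂ)
            (Submodule.span (algebraicClosure (IntermediateField.adjoin ℚ (Set.range (Complex.exp ∘ z))) ℂ)
              (insert (1 : ℂ) (Set.range z))) : Cardinal) +
          Algebra.trdeg ℚ (IntermediateField.adjoin ℚ (Set.range (Complex.exp ∘ z))) ≤
        Algebra.trdeg ℚ (IntermediateField.adjoin ℚ (Set.range z ∪ Set.range (Complex.exp ∘ z))) + 1 := by
  intro n z hz
  by_cases hL : ∀ i, z i ∈ algebraicClosure (IntermediateField.adjoin ℚ (Set.range (Complex.exp ∘ z))) ℂ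
  · exact Or.inr (h₂ n z hz hL)
  · push Not at hL
    by_cases hT : ∀ i, IsAlgebraic ℚ (Complex.exp (z i))
    · -- log sector: `z` is algebraically independent over `ℚ`, hence `n ≤ trdeg_ℚ ℚ(z, e^z)`
      left
      have halg : AlgebraicIndependent ℚ z := h₁ n z hT hz
      set F : IntermediateField ℚ ℂ :=
        IntermediateField.adjoin ℚ (Set.range z ∪ Set.range (Complex.exp ∘ z)) with hF
      let z' : Fin n → F := fun i => ⟨z i, IntermediateField.subset_adjoin ℚ _ (Or.inl ⟨i, rfl⟩)⟩
      have hz' : AlgebraicIndependent ℚ z' := AlgebraicIndependent.of_comp F.val halg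
      simpa using hz'.cardinalMk_le_trdeg
    · push Not at hT
      exact h₃ n z hz hT hL

/-- **The composition BY NAME**: the crux constant `AffineToAlgebraic` from the three registered
stubs (its axiom closure contains `sorryAx` exactly through `stub_logSector`, `stub_closureLayer`,
`stub_transcendentalLayer`; the glue `affineToAlgebraic_of_layers` is sorry-free). -/
theorem AffineToAlgebraic_of : AffineToAlgebraic :=
  affineToAlgebraic_of_layers stub_logSector stub_closureLayer stub_transcendentalLayer

end Summit.Schanuel.Schanuel.Cruxes.AffineToAlgebraic.Birth
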